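import Mathlib
import Summits.Ventures.HodgeRepro2.T5RecordSatakeDifferentChain
import Summits.Ventures.HodgeRepro2.T5RecordSatakeDifferentSummary

/-!
# THE RECORD'S SPHERICAL HECKE ALGEBRA ON EVERY CM FIELD, IN ONE STATEMENT

Tier-5 support N3 / §G-N4.2 (seat p3, gen 82). The consumer statement of the gen's different route (files 311,
313, 315, 316, 318): for EVERY CM field `K` and EVERY integral unimodular hermitian Gram matrix `H = M.map ι`
(`M ∈ GL₃(𝓞_K)`) there is `d ≠ 0` in `𝓞_{K⁺}` (the square of the datum `x` with `c(x) = −x`, file 235) such that at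
every place `v` of `K⁺` not dividing `(4d)`:

* the record's spherical Hecke algebra `H(U(1 ⊗ H), K_v)` is commutative;
* if `v` has one prime of `K` above it, the algebra is `k[X]` and the Satake chain holds with numerals
  `q = p^{f(v/p)}` (`v ∣ p`): `deg Tₙ = (q³ + 1) q^{4n−3}`, `T₁ T_{n+2} = T_{n+3} + (q − 1) T_{n+2} + q⁴ T_{n+1}`,
  `T₁² = T₂ + (q − 1) T₁ + (q⁴ + q) T₀`;

and the places dividing `(4d)` form a finite set. **`record_hecke_every_cm_field`** — no cyclotomic presentation, no
local hypothesis, every number-theoretic input in kernel; what stays print for the lane is listed in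
T5-SATAKE-KERNEL-p3.md (Kronecker–Weber for the cyclotomic census only; rows 12–14 on the record's pair; clause
(u2); the bad-place lattice; the principal-series identification).

§8(d): uses an L-value-free non-vanishing device: NO.
-/

open Matrix NumberField NumberField.IsCMField IsDedekindDomain IsDedekindDomain.HeightOneSpectrum Module Polynomial
  Ideal
open scoped TensorProduct Pointwise
open Summit.Ventures.HodgeRepro2.T5UnitaryGroupForm Summit.Ventures.HodgeRepro2.T5UnitaryHeckeAdjoint
  Summit.Ventures.HodgeRepro2.T5HeckePermutationModule Summit.Ventures.HodgeRepro2.T5HeckeDoubleCoset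
  Summit.Ventures.HodgeRepro2.T5RecordHyperspecial Summit.Ventures.HodgeRepro2.T5GlobalLatticeAlmostAll
  Summit.Ventures.HodgeRepro2.T5FinitePlaceSplitClassification Summit.Ventures.HodgeRepro2.T5RecordSatakeIntrinsic
  Summit.Ventures.HodgeRepro2.T5SplitPlaceUnitaryGroup Summit.Ventures.HodgeRepro2.T5NonSplitPlaceUnitaryGroup
  Summit.Ventures.HodgeRepro2.T5FinitePlaceCM Summit.Ventures.HodgeRepro2.T5StarOfInvolution
  Summit.Ventures.HodgeRepro2.T5CyclotomicSubfieldHeckeCommutative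
  Summit.Ventures.HodgeRepro2.T5IntegralGramBadSet Summit.Ventures.HodgeRepro2.T5RecordSatakeDifferent
  Summit.Ventures.HodgeRepro2.T5CMFieldSquareDatum Summit.Ventures.HodgeRepro2.T5RecordSatakeDifferentDatum
  Summit.Ventures.HodgeRepro2.T5RecordSatakeDifferentSummary Summit.Ventures.HodgeRepro2.T5RecordSatakeDifferentChain
  Summit.Ventures.HodgeRepro2.T5CyclotomicTwentyOneSatake Summit.Ventures.HodgeRepro2.T5CyclotomicSevenHeckeCommutative

namespace Summit.Ventures.HodgeRepro2.T5RecordSatakeEveryCMField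

variable (K : Type*) [Field K] [NumberField K] [IsCMField K]
variable {r : ℕ} (l : Fin r → 𝓞 K) (k : Type*) [Field k] [CharZero k]
  (hl : Submodule.span (𝓞 (maximalRealSubfield K)) (Set.range l) = ⊤)
variable (M : Matrix (Fin 3) (Fin 3) (𝓞 K)) (hM : IsUnit M.det)
  (hH : ((algebraMap (𝓞 K) K).mapMatrix M).IsHermitian)

include hl hM hH in
/-- **THE RECORD'S SPHERICAL HECKE ALGEBRA ON EVERY CM FIELD, IN ONE STATEMENT**: for every CM field `K`, every
generator family `l`, every field `k` of characteristic `0` and every integral unimodular hermitian `H = M.map ι`,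
there is `d ≠ 0` in `𝓞_{K⁺}` such that (i) the places of `K⁺` dividing `(4d)` are finitely many; (ii) at every place
`v` not dividing `(4d)` the algebra is commutative; (iii) at every such `v` with one prime of `K` above it, lying over
the rational prime `p`, the algebra is `k[X]` and the Satake chain holds with numerals `q = p^{f(v/p)}`. -/
theorem record_hecke_every_cm_field :
    ∃ d : 𝓞 (maximalRealSubfield K), d ≠ 0 ∧
      {v : HeightOneSpectrum (𝓞 (maximalRealSubfield K)) | 4 * d ∈ v.asIdeal}.Finite ∧
      (∀ v : HeightOneSpectrum (𝓞 (maximalRealSubfield K)), 4 * d ∉ v.asIdeal →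
        RecordCommutative K v l k ((algebraMap (𝓞 K) K).mapMatrix M)) ∧
      (∀ v : HeightOneSpectrum (𝓞 (maximalRealSubfield K)), 4 * d ∉ v.asIdeal →
        (v.asIdeal.primesOver (𝓞 K)).ncard = 1 →
        RecordPolynomial K v l k ((algebraMap (𝓞 K) K).mapMatrix M) ∧
        ∀ (p : ℕ) [Fact p.Prime] [v.asIdeal.LiesOver (span {(p : ℤ)})],
          ChainNumerals K v l k ((algebraMap (𝓞 K) K).mapMatrix M) (p ^ v.asIdeal.inertiaDeg ℤ)
            ((p ^ v.asIdeal.inertiaDeg ℤ) ^ 3 + 1) ((p ^ v.asIdeal.inertiaDeg ℤ) ^ 4)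
            ((p ^ v.asIdeal.inertiaDeg ℤ) ^ 4 + p ^ v.asIdeal.inertiaDeg ℤ)) := by
  obtain ⟨d, x, hdx, hx, hd⟩ := exists_integer_datum_ne_zero K
  refine ⟨d, hd, finite_setOf_four_mul_mem K d hd, fun v hv => ?_, fun v hv h1 => ⟨?_, fun p _ _ => ?_⟩⟩
  · exact recordCommutative_of_four_mul_notMem K d x hdx hx v l k hl hv hH (isUnit_det_mapMatrix M hM)
      (forall_notMem_badSet_mapMatrix v M hM)
  · exact recordPolynomial_of_four_mul_notMem_integral K d x hdx hx v l k hl hv h1 M hM hH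
  · exact chainNumerals_of_four_mul_notMem_integral K d x hdx hx p v hv h1 l k hl M hM hH

end Summit.Ventures.HodgeRepro2.T5RecordSatakeEveryCMField
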